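import Summits.KontsevichZagierPeriods.KontsevichZagierPeriods.Theorems.HurwitzMicroSectorsNormalFormPrincipleDilogExistsBoxAtoms
import Literature.NumberTheory.Transcendental.KZProductIdeal
import Literature.NumberTheory.Transcendental.KZDominatedFamilyRelations

/-!
# `NormalFormPrinciple` (stmt-KontsevichZagierPeriods-3869), line `SketchIdeator1` —
# leaf `stub_boxRigidity`, layer `M3` (WeightDropTornheim): symmetrisation of the wedge

Pure proof file (registered sub-goal `wdt_wedge_symmetrise` of the layer `M3`, lead seat c9;
`--supports` the crux). In the move chain for the Tornheim weight drop
`[(0,1)³, 1/((1 − xy)(1 − xz))] ∼ [(0,1)², 2/(1 − xy)]`, the wedge chart `t = (x₀, x₀x₁, x₀x₂)`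
lands on the wedge representation `W = [V, g]`,
`V = {0 < t₁ < t₀, 0 < t₂ < t₀, t₀ < 1}`, `g(t) = 1/(t₀²(1 − t₁)(1 − t₂))`; both `V` and `g` are
symmetric under the swap of the coordinates `1, 2`. This file halves `W`: with the half-wedge
`V< = {0 < t₁ < t₂ < t₀ < 1}` and `W' = [V<, g]`,

1. `[W] − 2[W'] ∈ KZ.relations`: restrict `W` to the co-null subdomain `V< ∪ V>` (the complement
   in `V` lies on the plane `{t₁ = t₂}`, the zero set of the nonzero `ℚ`-polynomial `X₁ − X₂`,
   null by `volume_setOf_aeval_eq_zero`; rule (1),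
   `KZ.IntegralRep.of_sub_of_restrict_mem_relations`),
   split it by domain additivity (rule (1a), the two halves are disjoint) into `[W']` and the
   swapped half `[W' ∘ swap]`, and identify the latter with `[W']` by the coordinate permutation
   move (rule (2), `KZ.of_sub_of_reindex_mem_relations`);
2. given such a `W`, such a `W'` exists (the restriction of `W` to the `ℚ`-semialgebraic `V<`,
   with the displayed integrand).

References: M. Kontsevich, D. Zagier, *Periods* (2001), §1.1–1.2, rules (1), (2). No definitions
are introduced.
-/

noncomputable section

open MeasureTheory Set
open Literature.NumberTheory.Transcendental Literature.NumberTheory.Transcendental.KZ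
open Literature.ModelTheory.ExponentialFields (IsSemialgebraic)

namespace Summit.KontsevichZagierPeriods.HurwitzMicroSectors.NormalFormPrinciple.PiBox.M3

/-! ## The half-wedge is semialgebraic -/

/-- The half-wedge `V< = {0 < t₁ < t₂ < t₀ < 1}` is `ℚ`-semialgebraic (four strict `ℚ`-polynomial
inequalities). [folklore] -/
theorem wdt2_isSemialgebraic_halfWedge :
    IsSemialgebraic ℚ {t : Fin 3 → ℝ | 0 < t 1 ∧ t 1 < t 2 ∧ t 2 < t 0 ∧ t 0 < 1} := by
  have h1 : IsSemialgebraic ℚ {t : Fin 3 → ℝ | 0 < t 1} := by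
    simpa using Literature.ModelTheory.ExponentialFields.isSemialgebraic_setOf_eval_lt (k := ℚ)
      (R := ℝ) (0 : MvPolynomial (Fin 3) ℚ) (MvPolynomial.X 1)
  have h2 : IsSemialgebraic ℚ {t : Fin 3 → ℝ | t 1 < t 2} := by
    simpa using Literature.ModelTheory.ExponentialFields.isSemialgebraic_setOf_eval_lt (k := ℚ)
      (R := ℝ) (MvPolynomial.X 1 : MvPolynomial (Fin 3) ℚ) (MvPolynomial.X 2)
  have h3 : IsSemialgebraic ℚ {t : Fin 3 → ℝ | t 2 < t 0} := by
    simpa using Literature.ModelTheory.ExponentialFields.isSemialgebraic_setOf_eval_lt (k := ℚ)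
      (R := ℝ) (MvPolynomial.X 2 : MvPolynomial (Fin 3) ℚ) (MvPolynomial.X 0)
  have h4 : IsSemialgebraic ℚ {t : Fin 3 → ℝ | t 0 < 1} := by
    simpa using Literature.ModelTheory.ExponentialFields.isSemialgebraic_setOf_eval_lt (k := ℚ)
      (R := ℝ) (MvPolynomial.X 0 : MvPolynomial (Fin 3) ℚ) 1
  convert ((h1.inter h2).inter h3).inter h4 using 1
  ext t
  simp only [mem_setOf_eq, mem_inter_iff, and_assoc]

/-! ## The swapped half-wedge -/

/-- The domain of the half-wedge representation `[{0 < t₁ < t₂ < t₀ < 1}, ·]` reindexed along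
`Equiv.swap 1 2` is the other half `{0 < t₂ < t₁ < t₀ < 1}`. [folklore] -/
theorem wdt2_reindex_swap_domain (W' : IntegralRep 3)
    (hW'd : W'.domain = {t | 0 < t 1 ∧ t 1 < t 2 ∧ t 2 < t 0 ∧ t 0 < 1}) :
    (W'.reindex (Equiv.swap (1 : Fin 3) 2)).domain =
      {t | 0 < t 2 ∧ t 2 < t 1 ∧ t 1 < t 0 ∧ t 0 < 1} := by
  have hs0 : Equiv.swap (1 : Fin 3) 2 0 = 0 := by decide
  ext w
  simp only [IntegralRep.reindex_domain, hW'd, mem_setOf_eq, Equiv.swap_apply_left,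
    Equiv.swap_apply_right, hs0]

/-- The integrand of the half-wedge representation reindexed along `Equiv.swap 1 2` agrees with
the (swap-symmetric) function `g(t) = 1/(t₀²(1 − t₁)(1 − t₂))` on its domain. [folklore] -/
theorem wdt2_reindex_swap_integrand (W' : IntegralRep 3)
    (hW'i : EqOn W'.integrand (fun t => 1 / (t 0 ^ 2 * (1 - t 1) * (1 - t 2))) W'.domain) :
    EqOn (W'.reindex (Equiv.swap (1 : Fin 3) 2)).integrand
      (fun t => 1 / (t 0 ^ 2 * (1 - t 1) * (1 - t 2)))
      (W'.reindex (Equiv.swap (1 : Fin 3) 2)).domain := by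
  intro w hw
  have hw' : (fun i => w (Equiv.swap (1 : Fin 3) 2 i)) ∈ W'.domain := by
    rw [IntegralRep.reindex_domain] at hw
    exact hw
  rw [IntegralRep.reindex_integrand]
  show W'.integrand (fun i => w (Equiv.swap (1 : Fin 3) 2 i)) =
    1 / (w 0 ^ 2 * (1 - w 1) * (1 - w 2))
  have hs0 : Equiv.swap (1 : Fin 3) 2 0 = 0 := by decide
  rw [hW'i hw']
  simp only [Equiv.swap_apply_left, Equiv.swap_apply_right, hs0]
  ring

/-! ## The registered sub-goal -/

/-- **Stub T2 (`wdt_wedge_symmetrise`; registered sub-goal of stmt-KontsevichZagierPeriods-3869,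
line `SketchIdeator1`, layer `M3`).** Symmetrisation of the wedge of the Tornheim weight-drop
chain: with `V = {0 < t₁ < t₀, 0 < t₂ < t₀, t₀ < 1}`, `V< = {0 < t₁ < t₂ < t₀ < 1}` and
`g(t) = 1/(t₀²(1 − t₁)(1 − t₂))` (symmetric in `t₁, t₂`):
(1) for any representations `W = [V, ·]`, `W' = [V<, ·]` whose integrands agree with `g` on their
domains, `[W] − 2[W'] ∈ KZ.relations` — restriction of `W` off the null plane `{t₁ = t₂}`
(rule (1)), domain additivity `V< ∪ V>` (rule (1a)), and the coordinate swap `t₁ ↔ t₂` carrying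
`[W']` to the other half (rule (2), `KZ.of_sub_of_reindex_mem_relations`);
(2) given such a `W`, such a `W'` exists (restriction of `W` to the `ℚ`-semialgebraic `V<`).
[cite: KontsevichZagier2001, §1.2 rules (1), (2)] -/
theorem wdt_wedge_symmetrise :
    (∀ (W W' : IntegralRep 3),
      W.domain = {t | 0 < t 1 ∧ t 1 < t 0 ∧ 0 < t 2 ∧ t 2 < t 0 ∧ t 0 < 1} →
      EqOn W.integrand (fun t => 1 / (t 0 ^ 2 * (1 - t 1) * (1 - t 2))) W.domain →
      W'.domain = {t | 0 < t 1 ∧ t 1 < t 2 ∧ t 2 < t 0 ∧ t 0 < 1} →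
      EqOn W'.integrand (fun t => 1 / (t 0 ^ 2 * (1 - t 1) * (1 - t 2))) W'.domain →
      of W - 2 • of W' ∈ relations) ∧
    (∀ (W : IntegralRep 3),
      W.domain = {t | 0 < t 1 ∧ t 1 < t 0 ∧ 0 < t 2 ∧ t 2 < t 0 ∧ t 0 < 1} →
      EqOn W.integrand (fun t => 1 / (t 0 ^ 2 * (1 - t 1) * (1 - t 2))) W.domain →
      ∃ W' : IntegralRep 3, W'.domain = {t | 0 < t 1 ∧ t 1 < t 2 ∧ t 2 < t 0 ∧ t 0 < 1} ∧
        W'.integrand = fun t => 1 / (t 0 ^ 2 * (1 - t 1) * (1 - t 2))) := by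
  refine ⟨fun W W' hWd hWi hW'd hW'i => ?_, fun W hWd hWi => ?_⟩
  · -- the swapped half `Ws = W' ∘ swap` and the permutation move `[W'] − [Ws]` (rule 2)
    have hsd := wdt2_reindex_swap_domain W' hW'd
    have hsi := wdt2_reindex_swap_integrand W' hW'i
    have e2 : of W' - of (W'.reindex (Equiv.swap (1 : Fin 3) 2)) ∈ relations :=
      of_sub_of_reindex_mem_relations W' (Equiv.swap (1 : Fin 3) 2)
    generalize W'.reindex (Equiv.swap (1 : Fin 3) 2) = Ws at hsd hsi e2
    -- the two halves sit inside the wedge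
    have hsubl : W'.domain ⊆ W.domain := by
      rw [hW'd, hWd]
      exact fun t ht => ⟨ht.1, ht.2.1.trans ht.2.2.1, ht.1.trans ht.2.1, ht.2.2.1, ht.2.2.2⟩
    have hsubg : Ws.domain ⊆ W.domain := by
      rw [hsd, hWd]
      exact fun t ht => ⟨ht.1.trans ht.2.1, ht.2.2.1, ht.1, ht.2.1.trans ht.2.2.1, ht.2.2.2⟩
    have hE : IsSemialgebraic ℚ (W'.domain ∪ Ws.domain) :=
      W'.isSemialgebraic_domain.union Ws.isSemialgebraic_domain
    have hEr : W'.domain ∪ Ws.domain ⊆ W.domain := union_subset hsubl hsubg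
    -- the plane `{t₁ = t₂}` is null (zero set of the nonzero `ℚ`-polynomial `X₁ − X₂`)
    have hplane : volume {t : Fin 3 → ℝ | t 1 = t 2} = 0 := by
      have hq : MvPolynomial.map (algebraMap ℚ ℝ)
          (MvPolynomial.X 1 - MvPolynomial.X 2 : MvPolynomial (Fin 3) ℚ) ≠ 0 := by
        rw [map_sub, MvPolynomial.map_X, MvPolynomial.map_X]
        exact sub_ne_zero.mpr (MvPolynomial.X_injective.ne (by decide))
      simpa [sub_eq_zero] using volume_setOf_aeval_eq_zero
        (MvPolynomial.X 1 - MvPolynomial.X 2 : MvPolynomial (Fin 3) ℚ) hq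
    -- the complement of the two halves in the wedge lies on the null plane `{t₁ = t₂}`
    have hvol : volume (W.domain \ (W'.domain ∪ Ws.domain)) = 0 := by
      refine measure_mono_null (fun t ht => ?_) hplane
      rw [hWd, hW'd, hsd] at ht
      obtain ⟨⟨h1, h10, h2, h20, h0⟩, hn⟩ := ht
      show t 1 = t 2
      by_contra hne
      rcases lt_or_gt_of_ne hne with h | h
      · exact hn (Or.inl ⟨h1, h, h20, h0⟩)
      · exact hn (Or.inr ⟨h2, h, h10, h0⟩)
    -- the two halves are disjoint
    have hint : volume (W'.domain ∩ Ws.domain) = 0 := by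
      refine measure_mono_null (fun t ht => ?_) hplane
      rw [hW'd, hsd] at ht
      exact absurd (ht.1.2.1.trans ht.2.2.1) (lt_irrefl _)
    -- move 0 (rule 1): `[W] − [W|E]`, `E = V< ∪ V>` co-null in `V`
    have e0 : of W - of (W.restrict _ hE hEr) ∈ relations :=
      W.of_sub_of_restrict_mem_relations hE hEr hvol
    -- move 1 (rule 1a): `[W|E] − [W'] − [Ws]`
    have e1 : of (W.restrict _ hE hEr) - of W' - of Ws ∈ relations :=
      domainAddRel_subset_relations ⟨3, W.restrict _ hE hEr, W', Ws, rfl, hint,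
        fun t ht => (hWi (hsubl ht)).trans (hW'i ht).symm,
        fun t ht => (hWi (hsubg ht)).trans (hsi ht).symm, rfl⟩
    -- bookkeeping
    have e : of W - 2 • of W' = (of W - of (W.restrict _ hE hEr)) +
        (of (W.restrict _ hE hEr) - of W' - of Ws) - (of W' - of Ws) := by
      rw [two_smul]
      abel
    rw [e]
    exact relations.sub_mem (relations.add_mem e0 e1) e2
  · -- existence of `W' = [V<, g]`
    have hV := wdt2_isSemialgebraic_halfWedge
    have hsub : {t : Fin 3 → ℝ | 0 < t 1 ∧ t 1 < t 2 ∧ t 2 < t 0 ∧ t 0 < 1} ⊆ W.domain := by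
      rw [hWd]
      exact fun t ht => ⟨ht.1, ht.2.1.trans ht.2.2.1, ht.1.trans ht.2.1, ht.2.2.1, ht.2.2.2⟩
    exact ⟨⟨{t | 0 < t 1 ∧ t 1 < t 2 ∧ t 2 < t 0 ∧ t 0 < 1},
      fun t => 1 / (t 0 ^ 2 * (1 - t 1) * (1 - t 2)), hV,
      (W.isSemialgebraicFunOn_integrand.mono hsub hV).congr (hWi.mono hsub),
      (W.integrableOn.mono_set hsub).congr_fun (hWi.mono hsub) hV.measurableSet_holds⟩, rfl, rfl⟩

end Summit.KontsevichZagierPeriods.HurwitzMicroSectors.NormalFormPrinciple.PiBox.M3
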